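import Mathlib
import Summits.Parity.BatemanHorn.Theses.PolynomialMobius
import HarnessLib

/-!
# Window swap (AUX1 of W1 `stub_nonlinear_window_of_level`, crux stmt-Parity-0870)

Exact exchange of the two finite summations in the "window" double sum
`W(x) = ∑_{n ≤ x} ∑_{d : dᵢ ∣ fᵢ(n)⁺} [L < ∏ dᵢ ≤ U] ∏ μ(dᵢ) log dᵢ`:

`W(x) = ∑_{d ∈ [1,⌊U⌋]^k} [L < ∏ dᵢ ≤ U] (∏ μ(dᵢ) log dᵢ) · #{n ∈ [1, x] : ∀ i, dᵢ ∣ fᵢ(n)⁺}`,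

with the same `Int.toNat` / `Nat.divisors` convention on both sides, so that this is an identity
for every `k`, `f`, `L`, `U`, `x` (no hypotheses).  Pure `Finset` bookkeeping:

* `mem_box_of_mem_divisors` — a tuple of divisors (of nonzero naturals) with real product `≤ U`
  lies in the box `[1, ⌊U⌋]^k`;
* `inner_sum_eq_box_sum` — for each `n` the inner sum is a sum over the box;
* `sum_ite_and_const` — summing a constant over a doubly-conditioned indicator;
* `stub_windowSwap` — the swap itself (`Finset.sum_comm`).
-/

open Finset Polynomial

namespace Summit.Parity.BatemanHorn.Theorems.PolyMobiusTail.NonlinearWindow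

/-- A tuple of divisors of (nonzero) naturals whose real product is `≤ U` lies in the box
`[1, ⌊U⌋]^k`. -/
private lemma mem_box_of_mem_divisors {k : ℕ} {m d : Fin k → ℕ} {U : ℝ}
    (hd : ∀ i, d i ∈ (m i).divisors) (hU : ∏ i, (d i : ℝ) ≤ U) :
    d ∈ Fintype.piFinset (fun _ : Fin k => Finset.Icc 1 ⌊U⌋₊) := by
  rw [Fintype.mem_piFinset]
  have hpos : ∀ i, 0 < d i := fun i => Nat.pos_of_mem_divisors (hd i)
  intro i
  rw [Finset.mem_Icc]
  refine ⟨hpos i, Nat.le_floor ?_⟩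
  have h1 : d i ≤ ∏ j, d j :=
    Nat.le_of_dvd (Finset.prod_pos fun j _ => hpos j)
      (Finset.dvd_prod_of_mem _ (Finset.mem_univ i))
  calc (d i : ℝ) ≤ ((∏ j, d j : ℕ) : ℝ) := by exact_mod_cast h1
    _ = ∏ j, (d j : ℝ) := by push_cast; rfl
    _ ≤ U := hU

/-- Step 1: for each `n` (here encoded by the tuple `m = (fᵢ(n)⁺)ᵢ`), the inner sum over divisor
tuples with `L < ∏ dᵢ ≤ U` equals the sum over the box `[1, ⌊U⌋]^k` of the doubly-conditioned
indicator. -/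
private lemma inner_sum_eq_box_sum {k : ℕ} (m : Fin k → ℕ) (L U : ℝ) (w : (Fin k → ℕ) → ℝ) :
    (∑ d ∈ Fintype.piFinset (fun i => (m i).divisors),
      if L < ∏ i, (d i : ℝ) ∧ ∏ i, (d i : ℝ) ≤ U then w d else 0) =
    ∑ d ∈ Fintype.piFinset (fun _ : Fin k => Finset.Icc 1 ⌊U⌋₊),
      if (L < ∏ i, (d i : ℝ) ∧ ∏ i, (d i : ℝ) ≤ U) ∧ (∀ i, d i ∈ (m i).divisors) then w d
      else 0 := by
  classical
  rw [← Finset.sum_filter, ← Finset.sum_filter]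
  refine Finset.sum_congr ?_ fun _ _ => rfl
  ext d
  simp only [Finset.mem_filter]
  constructor
  · rintro ⟨hd, hcond⟩
    have hd' : ∀ i, d i ∈ (m i).divisors := Fintype.mem_piFinset.mp hd
    exact ⟨mem_box_of_mem_divisors hd' hcond.2, hcond, hd'⟩
  · rintro ⟨-, hcond, hd⟩
    exact ⟨Fintype.mem_piFinset.mpr hd, hcond⟩

/-- Step 3: for a fixed tuple, summing the doubly-conditioned constant indicator over `n` gives the
constant times the number of admissible `n`. -/
private lemma sum_ite_and_const (s : Finset ℕ) (c : Prop) [Decidable c] (p : ℕ → Prop)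
    [DecidablePred p] (a : ℝ) :
    (∑ n ∈ s, if c ∧ p n then a else 0) = if c then a * ((s.filter p).card : ℝ) else 0 := by
  by_cases hc : c
  · rw [if_pos hc]
    have h2 : ∀ n ∈ s, (if c ∧ p n then a else (0 : ℝ)) = if p n then a else 0 :=
      fun n _ => if_congr (and_iff_right hc) rfl rfl
    rw [Finset.sum_congr rfl h2, ← Finset.sum_filter, Finset.sum_const, nsmul_eq_mul, mul_comm]
  · rw [if_neg hc]
    exact Finset.sum_eq_zero fun n _ => if_neg fun h => hc h.1

/-- **AUX1 of W1 (`stub_windowSwap`)**: exact exchange of the two finite summations in the window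
double sum,
`∑_{n ≤ x} ∑_{dᵢ ∣ fᵢ(n)⁺} [L < ∏ dᵢ ≤ U] ∏ μ(dᵢ) log dᵢ
  = ∑_{d ∈ [1,⌊U⌋]^k} [L < ∏ dᵢ ≤ U] (∏ μ(dᵢ) log dᵢ) · #{n ∈ [1,x] : ∀ i, dᵢ ∣ fᵢ(n)⁺}`.
No hypotheses on `k`, `f`, `L`, `U`, `x`. -/
theorem stub_windowSwap : ∀ (k : ℕ) (f : Fin k → ℤ[X]) (L U : ℝ) (x : ℕ),
    (∑ n ∈ Finset.Icc 1 x, ∑ d ∈ Fintype.piFinset (fun i => (((f i).eval (n : ℤ)).toNat).divisors),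
      if L < ∏ i, (d i : ℝ) ∧ ∏ i, (d i : ℝ) ≤ U then
        ∏ i, ((ArithmeticFunction.moebius (d i) : ℝ) * Real.log (d i)) else 0) =
    ∑ d ∈ Fintype.piFinset (fun _ : Fin k => Finset.Icc 1 ⌊U⌋₊),
      if L < ∏ i, (d i : ℝ) ∧ ∏ i, (d i : ℝ) ≤ U then
        (∏ i, ((ArithmeticFunction.moebius (d i) : ℝ) * Real.log (d i))) *
          (((((Finset.Icc 1 x).filter (fun n : ℕ =>
              ∀ i, d i ∈ (((f i).eval (n : ℤ)).toNat).divisors)).card : ℕ) : ℝ)) else 0 := by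
  intro k f L U x
  rw [Finset.sum_congr rfl fun (n : ℕ) _ =>
      inner_sum_eq_box_sum (fun i => ((f i).eval (n : ℤ)).toNat) L U
        (fun d => ∏ i, ((ArithmeticFunction.moebius (d i) : ℝ) * Real.log (d i))),
    Finset.sum_comm]
  refine Finset.sum_congr rfl fun d _ => ?_
  exact sum_ite_and_const (Finset.Icc 1 x) _ (fun n => ∀ i, d i ∈ (((f i).eval (n : ℤ)).toNat).divisors) _

end Summit.Parity.BatemanHorn.Theorems.PolyMobiusTail.NonlinearWindow
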